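import Summits.ValiantsHypothesis.ValiantsHypothesis.Theorems.PolyaContinuedSignedCoverLittleEarA
import Mathlib.GroupTheory.Perm.Cycle.Concrete
import Mathlib.Data.List.OfFn
import HarnessLib

/-!
# Route PolyaContinued — support item `SignedCoverLittle` (stmt-ValiantsHypothesis-7426):
# ear lemma, part B — distance arithmetic on a circuit and the splice of two paths

Continues `…EarA.lean` (cyclic distance `cdist`, directed paths `pathSet`).

* `mem_pathSet_iff_exists_pow` — the path from `x` to `y` is `{(σ ^ i) x : i < cdist σ x y}`;
* `cdist_add`, `cdist_add_cdist_rev` — additivity of the cyclic distance along a path, and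
  `cdist x y + cdist y x = orderOf σ` for `x ≠ y` (going around the circuit);
* `exists_splice_cycle` — **splicing**: if `μ, ν` are cyclic permutations, `p ≠ q` lie on both,
  and the `μ`-path from `p` to `q` is disjoint from the `ν`-path from `q` back to `p`, then
  "follow `μ` from `p` to `q`, then `ν` from `q` to `p`" is a cyclic permutation: it agrees with
  `μ` on the first path, with `ν` on the second, fixes everything else, and its support is the
  union of the two paths. (Built as `List.formPerm` of the spliced vertex list.) This produces the
  single-ear circuits and the forbidden two-ear circuit of the ear lemma.
-/

namespace Summit.ValiantsHypothesis.PolyaContinued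

open Equiv Equiv.Perm Finset

variable {α : Type*} [Fintype α] [DecidableEq α]

/-! ### Paths as sets of iterates; distance arithmetic -/

/-- The path from `x` to `y` consists of the iterates `(σ ^ i) x`, `i < cdist σ x y`. [folklore] -/
theorem mem_pathSet_iff_exists_pow {σ : Perm α} (hσ : σ.IsCycle) {x y v : α} (hx : x ∈ σ.support)
    (hy : y ∈ σ.support) : v ∈ pathSet σ x y ↔ ∃ i, i < cdist σ x y ∧ (σ ^ i) x = v := by
  constructor
  · intro hv
    obtain ⟨hvs, hlt⟩ := mem_pathSet.1 hv
    exact ⟨cdist σ x v, hlt, pow_cdist_apply_of_mem hσ hx hvs⟩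
  · rintro ⟨i, hi, rfl⟩
    refine mem_pathSet.2 ⟨pow_apply_mem_support.2 hx, ?_⟩
    rwa [cdist_eq_of_pow_apply hσ hx (lt_trans hi (cdist_lt_orderOf hσ hx hy)) rfl]

/-- Additivity of the cyclic distance along a path: if `v` is reached from `x` no later than `y`,
then `cdist x y = cdist x v + cdist v y`. [folklore] -/
theorem cdist_add {σ : Perm α} (hσ : σ.IsCycle) {x v y : α} (hx : x ∈ σ.support)
    (hv : v ∈ σ.support) (hy : y ∈ σ.support) (hle : cdist σ x v ≤ cdist σ x y) :
    cdist σ x y = cdist σ x v + cdist σ v y := by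
  have key : (σ ^ (cdist σ x y - cdist σ x v)) v = y := by
    have h1 := pow_cdist_apply_of_mem hσ hx hv
    calc (σ ^ (cdist σ x y - cdist σ x v)) v
        = (σ ^ (cdist σ x y - cdist σ x v)) ((σ ^ cdist σ x v) x) := by rw [h1]
      _ = y := by
          rw [← Perm.mul_apply, ← pow_add, Nat.sub_add_cancel hle, pow_cdist_apply_of_mem hσ hx hy]
  have hlt : cdist σ x y - cdist σ x v < orderOf σ :=
    lt_of_le_of_lt (Nat.sub_le _ _) (cdist_lt_orderOf hσ hx hy)
  have := cdist_eq_of_pow_apply hσ hv hlt key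
  omega

/-- Going around the circuit: for `x ≠ y` on a cycle, `cdist x y + cdist y x = orderOf σ`.
[folklore] -/
theorem cdist_add_cdist_rev {σ : Perm α} (hσ : σ.IsCycle) {x y : α} (hx : x ∈ σ.support)
    (hy : y ∈ σ.support) (hxy : x ≠ y) : cdist σ x y + cdist σ y x = orderOf σ := by
  -- `(σ ^ (cdist x y + cdist y x)) x = x`, and the sum is in `(0, 2 · order)`
  have key : (σ ^ (cdist σ y x + cdist σ x y)) x = x := by
    rw [pow_add, Perm.mul_apply, pow_cdist_apply_of_mem hσ hx hy, pow_cdist_apply_of_mem hσ hy hx]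
  have h1 : σ ^ (cdist σ y x + cdist σ x y) = 1 :=
    (hσ.pow_eq_one_iff' (mem_support.1 hx)).2 key
  have hdvd : orderOf σ ∣ cdist σ y x + cdist σ x y := orderOf_dvd_of_pow_eq_one h1
  have hlt : cdist σ y x + cdist σ x y < 2 * orderOf σ := by
    have := cdist_lt_orderOf hσ hx hy; have := cdist_lt_orderOf hσ hy hx; omega
  have hpos : 0 < cdist σ x y := by
    rw [pos_iff_ne_zero, Ne, cdist_eq_zero_iff hσ hx hy]; exact fun h => hxy h.symm
  obtain ⟨c, hc⟩ := hdvd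
  have hc1 : c = 1 := by
    rcases c with _ | _ | c
    · rw [mul_zero] at hc; omega
    · rfl
    · have : orderOf σ * 2 ≤ orderOf σ * (c + 1 + 1) := Nat.mul_le_mul_left _ (by omega)
      omega
  rw [hc1, mul_one] at hc
  omega

/-- A point of the path from `x` to `y` other than... : every tail `v` of the path from `x` to
`y` satisfies `cdist v y ≤ cdist x y` hence the path from `v` to `y` is contained in the path from
`x` to `y`. [folklore] -/
theorem pathSet_subset_of_mem {σ : Perm α} (hσ : σ.IsCycle) {x y v : α} (hx : x ∈ σ.support)
    (hy : y ∈ σ.support) (hv : v ∈ pathSet σ x y) : pathSet σ v y ⊆ pathSet σ x y := by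
  intro w hw
  obtain ⟨hvs, hvlt⟩ := mem_pathSet.1 hv
  obtain ⟨hws, hwlt⟩ := mem_pathSet.1 hw
  have hadd := cdist_add hσ hx hvs hy hvlt.le
  -- `w = σ^i v` with `i < cdist v y`, so `cdist x w ≤ cdist x v + i < cdist x y`
  obtain ⟨i, hi, rfl⟩ := (mem_pathSet_iff_exists_pow hσ hvs hy).1 hw
  refine mem_pathSet.2 ⟨hws, ?_⟩
  have : (σ ^ (cdist σ x v + i)) x = (σ ^ i) v := by
    rw [add_comm, pow_add, Perm.mul_apply, pow_cdist_apply_of_mem hσ hx hvs]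
  have hle := cdist_le_of_pow_apply this
  omega

/-! ### Splicing two paths into a circuit -/

omit [Fintype α] in
/-- Values of `List.formPerm` on a duplicate-free list presented by a "successor" function: if
`f` sends each entry to the next one and the last entry to the first, then `formPerm` agrees with
`f` on the list. [folklore] -/
theorem formPerm_apply_eq_of_getElem {l : List α} (hl : l.Nodup) (f : α → α) (hne : 0 < l.length)
    (hchain : ∀ (i : ℕ) (hi : i + 1 < l.length), f (l[i]'(by omega)) = l[i + 1])
    (hwrap : f (l[l.length - 1]'(by omega)) = l[0]) : ∀ v ∈ l, l.formPerm v = f v := by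
  intro v hv
  obtain ⟨i, hi, rfl⟩ := List.getElem_of_mem hv
  by_cases h : i + 1 < l.length
  · rw [List.formPerm_apply_lt_getElem l hl i h, hchain i h]
  · have hi' : i = l.length - 1 := by omega
    subst hi'
    rw [List.formPerm_apply_getElem l hl, hwrap]
    congr 1
    rw [Nat.sub_add_cancel (by omega : 1 ≤ l.length), Nat.mod_self]

omit [Fintype α] [DecidableEq α] in
/-- A list of length at least two is not a singleton. [folklore] -/
theorem ne_singleton_of_two_le {l : List α} (h : 2 ≤ l.length) (x : α) : l ≠ [x] := by
  rintro rfl; simp at h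

/-- **Splice of two paths.** Let `μ, ν` be cyclic permutations and `p ≠ q` points of both
supports such that the `μ`-path from `p` to `q` and the `ν`-path from `q` to `p` have no tail in
common. Then there is a cyclic permutation `c` following `μ` on the first path and `ν` on the
second, fixing all other points, with support the union of the two paths. [folklore] -/
theorem exists_splice_cycle {μ ν : Perm α} (hμ : μ.IsCycle) (hν : ν.IsCycle) {p q : α}
    (hpμ : p ∈ μ.support) (hqμ : q ∈ μ.support) (hpν : p ∈ ν.support) (hqν : q ∈ ν.support)
    (hpq : p ≠ q) (hdisj : Disjoint (pathSet μ p q) (pathSet ν q p)) :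
    ∃ c : Perm α, c.IsCycle ∧ (∀ v ∈ pathSet μ p q, c v = μ v) ∧
      (∀ v ∈ pathSet ν q p, c v = ν v) ∧
      (∀ v, v ∉ pathSet μ p q → v ∉ pathSet ν q p → c v = v) ∧
      c.support = pathSet μ p q ∪ pathSet ν q p := by
  classical
  set k := cdist μ p q with hk
  set d := cdist ν q p with hd
  have hk0 : 0 < k := by
    rw [hk, pos_iff_ne_zero, Ne, cdist_eq_zero_iff hμ hpμ hqμ]; exact fun h => hpq h.symm
  have hd0 : 0 < d := by
    rw [hd, pos_iff_ne_zero, Ne, cdist_eq_zero_iff hν hqν hpν]; exact hpq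
  have hko : k < orderOf μ := cdist_lt_orderOf hμ hpμ hqμ
  have hdo : d < orderOf ν := cdist_lt_orderOf hν hqν hpν
  -- the spliced vertex list
  let g : Fin (k + d) → α := fun i => if (i : ℕ) < k then (μ ^ (i : ℕ)) p else (ν ^ ((i : ℕ) - k)) q
  have hlen : (List.ofFn g).length = k + d := List.length_ofFn
  have hget : ∀ (i : ℕ) (hi : i < (List.ofFn g).length), (List.ofFn g)[i] =
      if i < k then (μ ^ i) p else (ν ^ (i - k)) q := by
    intro i hi
    rw [List.getElem_ofFn]
  -- membership
  have hmem : ∀ v, v ∈ List.ofFn g ↔ v ∈ pathSet μ p q ∨ v ∈ pathSet ν q p := by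
    intro v
    rw [List.mem_ofFn]
    constructor
    · rintro ⟨i, rfl⟩
      by_cases hi : (i : ℕ) < k
      · left
        simp only [g, if_pos hi]
        exact (mem_pathSet_iff_exists_pow hμ hpμ hqμ).2 ⟨i, hi, rfl⟩
      · right
        simp only [g, if_neg hi]
        exact (mem_pathSet_iff_exists_pow hν hqν hpν).2 ⟨(i : ℕ) - k, by omega, rfl⟩
    · rintro (hv | hv)
      · obtain ⟨i, hi, rfl⟩ := (mem_pathSet_iff_exists_pow hμ hpμ hqμ).1 hv
        exact ⟨⟨i, by omega⟩, by simp only [g]; rw [if_pos hi]⟩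
      · obtain ⟨j, hj, rfl⟩ := (mem_pathSet_iff_exists_pow hν hqν hpν).1 hv
        refine ⟨⟨k + j, by omega⟩, ?_⟩
        simp only [g]
        rw [if_neg (by omega)]
        congr 2
        omega
  -- no duplicates
  have hnodup : (List.ofFn g).Nodup := by
    rw [List.nodup_ofFn]
    intro i j hij
    simp only [g] at hij
    ext
    by_cases hi : (i : ℕ) < k <;> by_cases hj : (j : ℕ) < k
    · rw [if_pos hi, if_pos hj] at hij
      exact pow_apply_injOn hμ hpμ (lt_trans hi hko) (lt_trans hj hko) hij
    · rw [if_pos hi, if_neg hj] at hij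
      exfalso
      have h1 : (μ ^ (i : ℕ)) p ∈ pathSet μ p q :=
        (mem_pathSet_iff_exists_pow hμ hpμ hqμ).2 ⟨i, hi, rfl⟩
      have h2 : (ν ^ ((j : ℕ) - k)) q ∈ pathSet ν q p :=
        (mem_pathSet_iff_exists_pow hν hqν hpν).2 ⟨(j : ℕ) - k, by omega, rfl⟩
      rw [hij] at h1
      exact Finset.disjoint_left.1 hdisj h1 h2
    · rw [if_neg hi, if_pos hj] at hij
      exfalso
      have h1 : (μ ^ (j : ℕ)) p ∈ pathSet μ p q :=
        (mem_pathSet_iff_exists_pow hμ hpμ hqμ).2 ⟨j, hj, rfl⟩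
      have h2 : (ν ^ ((i : ℕ) - k)) q ∈ pathSet ν q p :=
        (mem_pathSet_iff_exists_pow hν hqν hpν).2 ⟨(i : ℕ) - k, by omega, rfl⟩
      rw [← hij] at h1
      exact Finset.disjoint_left.1 hdisj h1 h2
    · rw [if_neg hi, if_neg hj] at hij
      have := pow_apply_injOn hν hqν (by omega) (by omega) hij
      omega
  have htwo : 2 ≤ (List.ofFn g).length := by rw [hlen]; omega
  -- the successor function
  let f : α → α := fun v => if v ∈ pathSet μ p q then μ v else ν v
  have hf : ∀ v ∈ List.ofFn g, (List.ofFn g).formPerm v = f v := by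
    refine formPerm_apply_eq_of_getElem hnodup f (by omega) ?_ ?_
    · intro i hi
      rw [hget i (by omega), hget (i + 1) hi]
      by_cases hik : i < k
      · rw [if_pos hik]
        have hmemi : (μ ^ i) p ∈ pathSet μ p q :=
          (mem_pathSet_iff_exists_pow hμ hpμ hqμ).2 ⟨i, hik, rfl⟩
        simp only [f, if_pos hmemi]
        by_cases hik1 : i + 1 < k
        · rw [if_pos hik1, pow_succ', Perm.mul_apply]
        · rw [if_neg hik1]
          have : i + 1 = k := by omega
          rw [show i + 1 - k = 0 by omega, pow_zero, Perm.one_apply, ← Perm.mul_apply, ← pow_succ',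
            this, hk, pow_cdist_apply_of_mem hμ hpμ hqμ]
      · rw [if_neg hik, if_neg (by omega)]
        have hmemi : (ν ^ (i - k)) q ∈ pathSet ν q p :=
          (mem_pathSet_iff_exists_pow hν hqν hpν).2 ⟨i - k, by omega, rfl⟩
        have hnot : (ν ^ (i - k)) q ∉ pathSet μ p q :=
          fun h => Finset.disjoint_left.1 hdisj h hmemi
        simp only [f, if_neg hnot]
        rw [← Perm.mul_apply, ← pow_succ']
        congr 2
        omega
    · rw [hget _ (by omega), hget 0 (by omega), if_neg (by omega), if_pos hk0, pow_zero,
        Perm.one_apply]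
      have hmemi : (ν ^ ((List.ofFn g).length - 1 - k)) q ∈ pathSet ν q p :=
        (mem_pathSet_iff_exists_pow hν hqν hpν).2 ⟨(List.ofFn g).length - 1 - k, by omega, rfl⟩
      have hnot : (ν ^ ((List.ofFn g).length - 1 - k)) q ∉ pathSet μ p q :=
        fun h => Finset.disjoint_left.1 hdisj h hmemi
      simp only [f, if_neg hnot]
      rw [← Perm.mul_apply, ← pow_succ', show (List.ofFn g).length - 1 - k + 1 = d by omega, hd,
        pow_cdist_apply_of_mem hν hqν hpν]
  refine ⟨(List.ofFn g).formPerm, List.isCycle_formPerm hnodup htwo, ?_, ?_, ?_, ?_⟩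
  · intro v hv
    rw [hf v ((hmem v).2 (Or.inl hv))]
    exact if_pos hv
  · intro v hv
    rw [hf v ((hmem v).2 (Or.inr hv))]
    exact if_neg fun h => Finset.disjoint_left.1 hdisj h hv
  · intro v h1 h2
    exact List.formPerm_apply_of_notMem fun h => ((hmem v).1 h).elim h1 h2
  · rw [List.support_formPerm_of_nodup _ hnodup (ne_singleton_of_two_le htwo)]
    ext v
    rw [List.mem_toFinset, hmem, Finset.mem_union]

end Summit.ValiantsHypothesis.PolyaContinued
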